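import Mathlib
import Literature.NumberTheory.LFunctions.Zhang2022.Section11E2MeanSquare
import Literature.NumberTheory.LFunctions.Zhang2022.Section7SjPolylog
import Literature.NumberTheory.LFunctions.Zhang2022.TypedSection12A
import Literature.NumberTheory.LFunctions.Zhang2022.Section4Prop22Eventually
import Literature.NumberTheory.LFunctions.Zhang2022.Section7Prop71Holds
import HarnessLib

/-!
# Zhang (2022) §12 p. 67: the shifted `E₂` mean square `ΣΣ𝔠*(ρ,ψ)E(ρ+β₆,ψ)²ω(ρ) = o(𝔞𝔓)`

Topic `Literature/NumberTheory/LFunctions/Zhang2022` (Landau–Siegel audit tree; verdict-neutral).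
Y. Zhang, *Discrete mean estimates and the Landau–Siegel zero*, arXiv:2211.02515v1 (2022)
[Zhang2022LandauSiegel], §12 p. 67 (tex L3440): "Thus, in a way similar to the proof of
Proposition 2.6, by the above discussion we deduce (12.8)" — **an unrefereed manuscript under
adjudication; nothing here asserts or denies its Theorems 1–2.** The analogy with §11 (p. 65, tex
L3348–L3352, "`ΣΣ𝔠*(ρ,ψ)E₂(ρ,ψ)²ω(ρ) = o(𝔞𝔓)` … by (8.25), (8.26) and simple estimates") silently
invokes the `s + β₆` counterpart of that mean square, typed by the cell `siegel-zhang` as the CLAIM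
`Typed.Sec12A.E2ShiftMeanSq c′` (`TypedSection12A`, an antecedent of the (12.8)-deduction
`Typed.Sec12A.Ded128 c′`, hence of the leaf `Typed.Sec12A.Xi15Hbar16` of
`Skeleton.theorem1_of_leaves_v19`). THIS FILE PROVES IT, by the route the tree already uses for the
unshifted §11 claim (`Section11E2MeanSquare`, `Section11Leaves.step11u027_of_lemma81_prop71`):

* `add_beta6_mul_I` — `β₆ = 3iα/2` ((2.22)) is purely imaginary, so `s + β₆ + iv = s + i(3α/2 + v)`:
  the shift is a translation of the `v`-variable of `E(s,ψ)`;
* `E2main_shift_sq_le` — Cauchy–Schwarz in `v` (`0 < ω₁(iv) ≤ 1`):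
  `E(s+β₆,ψ)² ≤ 𝓛⁻¹³⁶·2𝓛²⁰·∫_{−𝓛²⁰}^{𝓛²⁰}|Σ_{n<P₁}χψ(n)n^{−(s+i(3α/2+v))}|²dv`
  (`Section11E2MeanSquare.E2main_sq_le` at `s + β₆`);
* `e2ShiftMeanSq_of_dmv` — a discrete mean-value bound
  `ΣΣ𝔠*(ρ,ψ)|Σ_{n<P₁}χψ(n)n^{−(ρ+iv)}|²ω(ρ) ≤ K𝓛^A𝔓` UNIFORM IN `v ∈ ℝ` (`A ≤ 95`) gives
  `ΣΣ𝔠*E(ρ+β₆,ψ)²ω ≤ 4K𝓛^{A−96}𝔓 = o(𝔞𝔓)` (`𝔞 ≫ 1`), verbatim as in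
  `Section11E2MeanSquare.step11u027_of_dmv` with `v` read `3α/2 + v`;
* `e2ShiftMeanSq_of_lemma81_prop71` — the mean-value bound is supplied by Lemma 8.1 + Prop. 7.1
  (`Section11E2MeanSquare.dmv_of_lemma81_prop71`) and the polylogarithmic majorant
  `|S_j(𝐚₁,𝐚₂)| ≤ K𝓛⁷²` (`XiZeroMajorant.sjPolylog`), so `A = 81`;
* `e2ShiftMeanSq_eventually` — closed form: for every sufficiently large `c′`, `E2ShiftMeanSq c′`
  holds outright (Lemma 2.3 and Lemma 8.1 from `Skeleton.partOne_eventually`, Prop. 2.2 (i)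
  `Skeleton.prop22i_holds`, Prop. 7.1 `Section7cStatements.prop71X_holds`, `𝔞 ≫ 1`
  `Skeleton.frakALowerBound_holds`).

Silent inputs made explicit (as in §11): Lemma 2.3 and Prop. 2.2 (i) (real non-negative weights
`𝔠*ω` at the zeros, which lie on `σ = 1/2`), `𝔞 ≫ 1`. 0 new definitions, 0 new facts; standard axioms.
ZHANG-L discharge lane (LIB-B, discrete mean values), 2026-08-26.

## References

* Y. Zhang, arXiv:2211.02515v1 (2022), §12 p. 67 (tex L3426–L3443), §11 p. 65, §2 (2.22).
  [cite: Zhang2022LandauSiegel, §12 (12.8) p. 67]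
-/

noncomputable section

open Complex Real ComplexConjugate MeasureTheory

namespace Literature.NumberTheory.LFunctions.Zhang2022.Section12E2ShiftMeanSquare

open Literature.NumberTheory.LFunctions.Zhang2022.Skeleton
open Literature.NumberTheory.LFunctions.Zhang2022.Typed.Sec12A
open Literature.NumberTheory.LFunctions.Zhang2022.Section11E2MeanSquare

/-! ### Elementary lemmas -/

/-- `log D ≥ 2` once `D ≥ 8`. [folklore] -/
private theorem two_le_log_of_eight_le {D : ℕ} (hD : 8 ≤ D) : 2 ≤ Real.log D := by
  have h8 : (8 : ℝ) ≤ D := by exact_mod_cast hD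
  have h2 : (2 : ℝ) ≤ Real.log 8 := by
    rw [Real.le_log_iff_exp_le (by norm_num)]
    have h1 := Real.exp_one_lt_d9
    have h0 := Real.exp_pos 1
    have hsq : Real.exp 2 = Real.exp 1 * Real.exp 1 := by rw [← Real.exp_add]; norm_num
    rw [hsq]
    nlinarith
  exact h2.trans (Real.log_le_log (by norm_num) h8)

/-- **`s + β₆ + iv = s + i(3α/2 + v)`**: `β₆ = 3iα/2` ((2.22)) is purely imaginary, so the shift by
`β₆` translates the `v`-variable. [cite: Zhang2022LandauSiegel, §2 (2.22)] -/
theorem add_beta6_mul_I (D : ℕ) (s : ℂ) (v : ℝ) :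
    s + beta6 D + v * I = s + ((3 * alpha D / 2 + v : ℝ) : ℂ) * I := by
  simp only [beta6]
  push_cast
  ring

section Main

variable (c' : ℝ) {D : ℕ} [NeZero D] (χ : DirichletCharacter ℂ D) (x : Chr D)

omit [NeZero D] in
/-- An index of the double sum `ΣΣ` of (2.16) is a pair `(ψ, ρ)` with `ψ ∈ Ψ₁`, `ρ ∈ 𝔷(ψ)`.
[cite: Zhang2022LandauSiegel, §2 (2.16)] -/
private theorem mem_idx {i : (_ : Chr D) × ℂ} (hi : i ∈ idx χ) :
    i.1 ∈ PsiOne χ ∧ i.2 ∈ zeroSet D i.1 := by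
  rw [idx, Finset.mem_sigma] at hi
  exact ⟨mem_of_mem_finsetOf hi.1, mem_of_mem_finsetOf hi.2⟩

omit [NeZero D] in
/-- **`E(s+β₆,ψ)² ≤ 𝓛⁻¹³⁶·2𝓛²⁰·∫_{−𝓛²⁰}^{𝓛²⁰}|Σ_{n<P₁}χψ(n)n^{−(s+i(3α/2+v))}|²dv`** (Cauchy–Schwarz
in `v`, `0 < ω₁(iv) ≤ 1`; the shift `β₆ = 3iα/2` moved into the `v`-variable), for `D ≥ 3`.
[cite: Zhang2022LandauSiegel, §12 p. 67; §11 Lemma 11.2] -/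
theorem E2main_shift_sq_le (hD : 3 ≤ D) (s : ℂ) :
    E2main χ x (s + beta6 D) ^ 2 ≤ ((ell D ^ 68)⁻¹) ^ 2 * (2 * ell D ^ 20) *
      ∫ v in (-(ell D ^ 20))..(ell D ^ 20),
        ‖∑ n ∈ Finset.Ico 1 ⌈Skeleton.P1 D⌉₊,
          pc χ x n * (n : ℂ) ^ (-(s + ((3 * alpha D / 2 + v : ℝ) : ℂ) * I))‖ ^ 2 := by
  have h := E2main_sq_le χ x hD (s + beta6 D)
  simp_rw [add_beta6_mul_I] at h
  exact h

omit [NeZero D] in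
/-- Continuity in `v` of `v ↦ |Σ_{1≤n<N} χψ(n)n^{−(s+i(3α/2+v))}|`.
[cite: Zhang2022LandauSiegel, §11 Lemma 11.2] -/
theorem continuous_norm_twistSum_shift (N : ℕ) (s : ℂ) :
    Continuous fun v : ℝ =>
      ‖∑ n ∈ Finset.Ico 1 N, pc χ x n * (n : ℂ) ^ (-(s + ((3 * alpha D / 2 + v : ℝ) : ℂ) * I))‖ :=
  (continuous_norm_twistSum χ x N s).comp (continuous_const.add continuous_id)

/-- **`E2ShiftMeanSq` from a discrete mean-value bound** with exponent `A ≤ 95`: if, under (A) and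
for `D` large, `ΣΣ𝔠*(ρ,ψ)|Σ_{n<P₁}χψ(n)n^{−(ρ+iv)}|²ω(ρ) ≤ K𝓛^A𝔓` for ALL real `v`, then
`ΣΣ𝔠*(ρ,ψ)E(ρ+β₆,ψ)²ω(ρ) = o(𝔞𝔓)` (indeed `≤ 4K𝓛^{A−96}𝔓`, and `𝔞 ≫ 1`) — the §11 argument
(`Section11E2MeanSquare.step11u027_of_dmv`) at `v` read `3α/2 + v`.
[cite: Zhang2022LandauSiegel, §12 p. 67, tex L3440; §11 p. 65, tex L3348–L3352] -/
theorem e2ShiftMeanSq_of_dmv {A : ℕ} (hA : A ≤ 95) (h23 : Lemma23 c') (h22 : Prop22i)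
    (ha : FrakALowerBound)
    (hdmv : ∃ K : ℝ, ForAllLarge fun D _ χ => AssumptionA D χ → ∀ v : ℝ,
      ∑ i ∈ idx χ, (cstar c' D i.1 i.2).re *
          ‖∑ n ∈ Finset.Ico 1 ⌈Skeleton.P1 D⌉₊, pc χ i.1 n * (n : ℂ) ^ (-(i.2 + v * I))‖ ^ 2 *
          (omegaW D i.2).re ≤ K * ell D ^ A * frakP D) :
    E2ShiftMeanSq c' := by
  intro ε hε
  obtain ⟨K, hdmv⟩ := hdmv
  obtain ⟨a₀, ha₀, ha⟩ := ha
  obtain ⟨D₀, h⟩ := ((h22.and h23).and hdmv).and ha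
  -- threshold: `4(|K|+1)/𝓛 ≤ ε a₀`
  set M : ℝ := 4 * (|K| + 1) / (ε * a₀) with hM
  have hM0 : 0 < M := by positivity
  set D₁ : ℕ := ⌈Real.exp M⌉₊ with hD₁
  refine ⟨max (max D₀ D₁) 8, fun D _ χ hD hq hp hA' => ?_⟩
  have hD8 : 8 ≤ D := le_trans (le_max_right _ _) hD
  have hD3 : 3 ≤ D := le_trans (by norm_num) hD8
  have hlog := two_le_log_of_eight_le hD8
  have hℓ : 2 ≤ ell D := by rw [ell]; exact hlog
  have hDD₁ : D₁ ≤ D := le_trans (le_trans (le_max_right _ _) (le_max_left _ _)) hD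
  obtain ⟨⟨⟨h22', h23'⟩, hdmv'⟩, ha'⟩ :=
    h D χ (le_trans (le_trans (le_max_left _ _) (le_max_left _ _)) hD) hq hp
  have mem : ∀ i ∈ idx χ, i.1 ∈ PsiOne χ ∧ i.2 ∈ zeroSet D i.1 := fun i hi => mem_idx χ hi
  have hre : ∀ i ∈ idx χ, i.2.re = 1 / 2 := fun i hi =>
    h22' i.1 (mem i hi).1 i.2 (mem_prodZeroSetOmega_of_mem_zeroSet χ (mem i hi).2)
  have hc0 : ∀ i ∈ idx χ, 0 ≤ (cstar c' D i.1 i.2).re := fun i hi =>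
    (h23' i.1 (mem i hi).1 i.2 (mem i hi).2).2
  have hω : ∀ i ∈ idx χ, 0 < (omegaW D i.2).re := fun i hi => (omegaW_re_pos hD3 (hre i hi)).1
  have hP : 0 ≤ frakP D := frakP_nonneg D
  have hℓ0 : 0 < ell D := by linarith
  set L : ℝ := ell D ^ 20 with hL
  have hL0' : 0 ≤ L := by positivity
  have hLL : -L ≤ L := by linarith
  -- abbreviations (the `v`-variable already shifted by `3α/2`)
  set F : ((_ : Chr D) × ℂ) → ℝ → ℝ := fun i v =>
    ‖∑ n ∈ Finset.Ico 1 ⌈Skeleton.P1 D⌉₊,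
      pc χ i.1 n * (n : ℂ) ^ (-(i.2 + ((3 * alpha D / 2 + v : ℝ) : ℂ) * I))‖ with hFdef
  set G : ℝ → ℝ := fun v =>
    ∑ i ∈ idx χ, (cstar c' D i.1 i.2).re * F i v ^ 2 * (omegaW D i.2).re with hGdef
  have hFc : ∀ i, Continuous (F i) := fun i => continuous_norm_twistSum_shift χ i.1 _ i.2
  have hGbound : ∀ v : ℝ, G v ≤ K * ell D ^ A * frakP D := fun v =>
    hdmv' hA' (3 * alpha D / 2 + v)
  have hG0 : ∀ v : ℝ, 0 ≤ G v := fun v =>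
    Finset.sum_nonneg fun i hi => mul_nonneg (mul_nonneg (hc0 i hi) (sq_nonneg _)) (hω i hi).le
  -- the v-integral of G
  have hintG : ∫ v in (-L)..L, G v ≤ K * ell D ^ A * frakP D * (2 * L) := by
    have hb : ∀ v ∈ Set.uIoc (-L) L, ‖G v‖ ≤ K * ell D ^ A * frakP D := fun v _ => by
      rw [Real.norm_of_nonneg (hG0 v)]; exact hGbound v
    have := intervalIntegral.norm_integral_le_of_norm_le_const hb
    rw [show |L - -L| = 2 * L by rw [abs_of_nonneg (by linarith)]; ring] at this
    exact le_trans (Real.le_norm_self _) this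
  -- termwise: `𝔠* E(ρ+β₆)² ω ≤ ℓ⁻¹³⁶·2L·𝔠*(∫F²)ω`
  have hterm : ∀ i ∈ idx χ,
      (cstar c' D i.1 i.2).re * E2main χ i.1 (i.2 + beta6 D) ^ 2 * (omegaW D i.2).re ≤
        ((ell D ^ 68)⁻¹) ^ 2 * (2 * L) *
          ((cstar c' D i.1 i.2).re * (∫ v in (-L)..L, F i v ^ 2) * (omegaW D i.2).re) := by
    intro i hi
    have h1 := E2main_shift_sq_le χ i.1 hD3 i.2
    have h2 := mul_le_mul_of_nonneg_right (mul_le_mul_of_nonneg_left h1 (hc0 i hi)) (hω i hi).le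
    calc _ ≤ (cstar c' D i.1 i.2).re * (((ell D ^ 68)⁻¹) ^ 2 * (2 * ell D ^ 20) *
          ∫ v in (-L)..L, F i v ^ 2) * (omegaW D i.2).re := h2
      _ = _ := by rw [hL]; ring
  -- interchange of the finite sum and the v-integral
  have hswap : ∑ i ∈ idx χ, (cstar c' D i.1 i.2).re * (∫ v in (-L)..L, F i v ^ 2) *
      (omegaW D i.2).re = ∫ v in (-L)..L, G v := by
    rw [hGdef, intervalIntegral.integral_finsetSum]
    · refine Finset.sum_congr rfl fun i _ => ?_
      rw [← intervalIntegral.integral_const_mul, ← intervalIntegral.integral_mul_const]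
    · intro i _
      exact ((continuous_const.mul ((hFc i).pow 2)).mul continuous_const).intervalIntegrable _ _
  -- the size of the constant
  have hsmall : ((ell D ^ 68)⁻¹) ^ 2 * (2 * L) * (K * ell D ^ A * frakP D * (2 * L)) ≤
      ε * a₀ * frakP D := by
    have hM1 : M ≤ ell D := by
      have hexp : Real.exp M ≤ D := le_trans (Nat.le_ceil _) (by exact_mod_cast hDD₁)
      have := Real.log_le_log (Real.exp_pos _) hexp
      rwa [Real.log_exp, ← ell] at this
    have hK : K * ell D ^ A ≤ (|K| + 1) * ell D ^ 95 := by
      have h1 : ell D ^ A ≤ ell D ^ 95 := pow_le_pow_right₀ (by linarith) hA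
      nlinarith [le_abs_self K, abs_nonneg K, pow_nonneg hℓ0.le A, h1]
    have e1 : ((ell D ^ 68)⁻¹) ^ 2 * (2 * L) * (K * ell D ^ A * frakP D * (2 * L)) =
        4 * (K * ell D ^ A) * frakP D / ell D ^ 96 := by
      rw [hL]; field_simp; ring
    rw [e1, div_le_iff₀ (by positivity)]
    have e2 : ell D ^ 96 = ell D ^ 95 * ell D := by ring
    have hεa : 4 * (|K| + 1) ≤ ε * a₀ * ell D := by
      have := (div_le_iff₀ (by positivity : 0 < ε * a₀)).mp hM1
      linarith
    calc 4 * (K * ell D ^ A) * frakP D ≤ 4 * ((|K| + 1) * ell D ^ 95) * frakP D := by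
          gcongr
      _ = (4 * (|K| + 1)) * ell D ^ 95 * frakP D := by ring
      _ ≤ (ε * a₀ * ell D) * ell D ^ 95 * frakP D := by gcongr
      _ = ε * a₀ * frakP D * ell D ^ 96 := by rw [e2]; ring
  have haA : a₀ ≤ frakA χ := ha' hA'
  have hsum : ∑ i ∈ idx χ, (cstar c' D i.1 i.2).re * E2main χ i.1 (i.2 + beta6 D) ^ 2 *
      (omegaW D i.2).re ≤ ε * frakA χ * frakP D :=
    calc ∑ i ∈ idx χ, (cstar c' D i.1 i.2).re * E2main χ i.1 (i.2 + beta6 D) ^ 2 *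
          (omegaW D i.2).re
        ≤ ∑ i ∈ idx χ, ((ell D ^ 68)⁻¹) ^ 2 * (2 * L) *
            ((cstar c' D i.1 i.2).re * (∫ v in (-L)..L, F i v ^ 2) * (omegaW D i.2).re) :=
          Finset.sum_le_sum hterm
      _ = ((ell D ^ 68)⁻¹) ^ 2 * (2 * L) * ∫ v in (-L)..L, G v := by
          rw [← Finset.mul_sum, hswap]
      _ ≤ ((ell D ^ 68)⁻¹) ^ 2 * (2 * L) * (K * ell D ^ A * frakP D * (2 * L)) :=
          mul_le_mul_of_nonneg_left hintG (by positivity)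
      _ ≤ ε * a₀ * frakP D := hsmall
      _ ≤ ε * frakA χ * frakP D := by gcongr
  have hsum0 : 0 ≤ ∑ i ∈ idx χ, (cstar c' D i.1 i.2).re * E2main χ i.1 (i.2 + beta6 D) ^ 2 *
      (omegaW D i.2).re :=
    Finset.sum_nonneg fun i hi => mul_nonneg (mul_nonneg (hc0 i hi) (sq_nonneg _)) (hω i hi).le
  rw [msE2shift, abs_of_nonneg hsum0]
  exact hsum

/-- **`E2ShiftMeanSq` reduced to `S_j ≪ 𝓛^B`**: Lemma 2.3, Prop. 2.2 (i), Lemma 8.1, Prop. 7.1,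
`𝔞 ≫ 1` and a bound `|S_j(𝐚₁,𝐚₂)| ≤ K𝓛^B` (`B ≤ 86`) for all sequences admissible for (7.2) with
`|a(n)| ≤ 1` imply `ΣΣ𝔠*(ρ,ψ)E(ρ+β₆,ψ)²ω(ρ) = o(𝔞𝔓)`.
[cite: Zhang2022LandauSiegel, §12 p. 67, tex L3440; §11 p. 65] -/
theorem e2ShiftMeanSq_of_sjBound {B : ℕ} (hB : B ≤ 86) (h23 : Lemma23 c') (h22 : Prop22i)
    (h81 : Lemma81 c') (h71 : Prop71 c') (ha : FrakALowerBound)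
    (hS : ∃ K : ℝ, ForAllLarge fun D _ _ => ∀ j ∈ ({1, 2, 3} : Finset ℕ), ∀ a₁ a₂ : ℕ → ℂ,
      Adm72 D 1 a₁ → Adm72 D 1 a₂ → ‖Sj c' D j a₁ a₂‖ ≤ K * ell D ^ B) :
    E2ShiftMeanSq c' :=
  e2ShiftMeanSq_of_dmv c' (A := B + 9) (by omega) h23 h22 ha
    (dmv_of_lemma81_prop71 c' h23 h22 h81 h71 hS)

/-- **`E2ShiftMeanSq c′` holds given Lemma 2.3, Prop. 2.2 (i), Lemma 8.1, Prop. 7.1 and `𝔞 ≫ 1`**: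
`ΣΣ𝔠*(ρ,ψ)E(ρ+β₆,ψ)²ω(ρ) = o(𝔞𝔓)` (`Typed.Sec12A.E2ShiftMeanSq`), the `s + β₆` analogue of the
last display of §11 that §12 p. 67 uses "in a way similar to the proof of Proposition 2.6", from
the manuscript's own Lemma 8.1 and Proposition 7.1 (`e2ShiftMeanSq_of_sjBound` with `B = 72 ≤ 86`,
the majorant `XiZeroMajorant.sjPolylog`). [cite: Zhang2022LandauSiegel, §12 p. 67, tex L3440] -/
theorem e2ShiftMeanSq_of_lemma81_prop71 (h23 : Lemma23 c') (h22 : Prop22i) (h81 : Lemma81 c')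
    (h71 : Prop71 c') (ha : FrakALowerBound) : E2ShiftMeanSq c' :=
  e2ShiftMeanSq_of_sjBound c' (B := 72) (by norm_num) h23 h22 h81 h71 ha
    (XiZeroMajorant.sjPolylog c')

end Main

/-- **`E2ShiftMeanSq c′` OUTRIGHT for every sufficiently large `c′`**: Lemma 2.3 and Lemma 8.1
(`Skeleton.partOne_eventually`), Prop. 2.2 (i) (`Skeleton.prop22i_holds`), Prop. 7.1
(`Section7cStatements.prop71X_holds`), `𝔞 ≫ 1` (`Skeleton.frakALowerBound_holds`) are tree theorems.
[cite: Zhang2022LandauSiegel, §12 p. 67, tex L3440] -/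
theorem e2ShiftMeanSq_eventually :
    ∃ c₀ : ℝ, 0 ≤ c₀ ∧ ∀ c' : ℝ, c₀ ≤ c' → E2ShiftMeanSq c' := by
  obtain ⟨c₀, h0, h⟩ := partOne_eventually
  exact ⟨c₀, h0, fun c' hc' =>
    e2ShiftMeanSq_of_lemma81_prop71 c' (h c' hc').2.1 prop22i_holds (h c' hc').2.2.1
      (Section7cStatements.prop71X_holds c') frakALowerBound_holds⟩

end Literature.NumberTheory.LFunctions.Zhang2022.Section12E2ShiftMeanSquare
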